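import Literature.AlgebraicGeometry.Resolution.MarkedIdeals
import Literature.AlgebraicGeometry.Resolution.SpreadingGerms
import Literature.AlgebraicGeometry.Resolution.IdealsSpreadFromLocalization
import Mathlib.AlgebraicGeometry.Noetherian
import HarnessLib

/-!
# Spreading boundary equations and normal-form data from a stalk to an affine neighbourhood

Topic: `Literature/AlgebraicGeometry/Resolution`. For an integral locally Noetherian scheme
`X`, a point `x`, a list `E` of (boundary) ideal sheaves and generators `g_j` of the stalks at
`x` of the members `D_j` of `E` through `x` which generate PRIME ideals of `𝒪_{X,x}` (regular
parameters), together with finitely many further germs `f_k` and unit germs `u_k`, there is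
an affine open neighbourhood `U` of `x` carrying sections with these germs such that
(`exists_affineOpen_spread`):

* the ideal of `D_j` on `U` is the principal ideal of the spread equation `g_j`, which is a
  PRIME ideal of `Γ(X, U)`;
* the members of `E` not through `x` have the unit ideal on `U`;
* the spread `u_k` are units of `Γ(X, U)`.

The proof spreads the germs (`SpreadingGerms.lean`), compares the finitely generated ideals
`D_j(U₁)`, `(g_j)` and the contraction of `g_j 𝒪_{X,x}` at the prime of `x`
(`IdealsSpreadFromLocalization.lean`), and passes to a basic open neighbourhood of `x`. This
is the "choose a small affine chart around the centre" step of the endgame of the crux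
`PicoverLocalModel` (local log-regular charts on the normalised `p`-cyclic cover).

Sources: folklore (EGA 0_I, (5.2.7); EGA I, (9.4.7)).
-/

noncomputable section

open CategoryTheory AlgebraicGeometry TopologicalSpace Opposite

namespace Literature.AlgebraicGeometry.Resolution

universe u

/-- Restricting sections along `V ≤ U` does not change germs. [folklore] -/
theorem germ_map_homOfLE {X : Scheme.{u}} {U V : X.Opens} (h : V ≤ U) (x : X) (hxV : x ∈ V)
    (s : Γ(X, U)) :
    X.presheaf.germ V x hxV (X.presheaf.map (homOfLE h).op s) = X.presheaf.germ U x (h hxV) s :=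
  TopCat.Presheaf.germ_res_apply X.presheaf (homOfLE h) x hxV s

/-- **Spreading boundary equations and germs to an affine neighbourhood.** See the module
docstring. [folklore] -/
theorem exists_affineOpen_spread {X : Scheme.{u}} [IsIntegral X] [IsLocallyNoetherian X]
    (E : List X.IdealSheafData) (x : X) {r : ℕ}
    (D : Fin r → {D : X.IdealSheafData // D ∈ E ∧ x ∈ D.support})
    (hDsurj : ∀ D' ∈ E, x ∈ D'.support → ∃ j, (D j).1 = D')
    (g : Fin r → X.presheaf.stalk x) (hg : ∀ j, stalkIdeal (D j).1 x = Ideal.span {g j})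
    (hgprime : ∀ j, (Ideal.span {g j}).IsPrime)
    {m : ℕ} (f : Fin m → X.presheaf.stalk x)
    {m' : ℕ} (uu : Fin m' → X.presheaf.stalk x) (huu : ∀ k, IsUnit (uu k)) :
    ∃ (U : X.affineOpens) (hxU : x ∈ (U : X.Opens)) (gs : Fin r → Γ(X, (U : X.Opens)))
      (fs : Fin m → Γ(X, (U : X.Opens))) (us : Fin m' → Γ(X, (U : X.Opens))),
      (∀ j, X.presheaf.germ (U : X.Opens) x hxU (gs j) = g j) ∧
      (∀ k, X.presheaf.germ (U : X.Opens) x hxU (fs k) = f k) ∧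
      (∀ k, X.presheaf.germ (U : X.Opens) x hxU (us k) = uu k) ∧
      (∀ k, IsUnit (us k)) ∧
      (∀ j, (D j).1.ideal U = Ideal.span {gs j}) ∧
      (∀ D' ∈ E, (∀ j, (D j).1 ≠ D') → D'.ideal U = ⊤) ∧
      (∀ j, (Ideal.span {gs j}).IsPrime) := by
  classical
  -- spread all germs to one affine open `U₁`
  obtain ⟨Ua, hxa, -, ga, hga⟩ := exists_affineOpen_sections_of_germs X x g ⊤ trivial
  obtain ⟨Ub, hxb, hba, fb, hfb⟩ := exists_affineOpen_sections_of_germs X x f (Ua : X.Opens) hxa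
  obtain ⟨U₁, hx₁, h₁b, u₁, hu₁⟩ := exists_affineOpen_sections_of_germs X x uu (Ub : X.Opens) hxb
  have h₁a : (U₁ : X.Opens) ≤ Ua := h₁b.trans hba
  set g₁ : Fin r → Γ(X, (U₁ : X.Opens)) := fun j => X.presheaf.map (homOfLE h₁a).op (ga j) with hg₁def
  set f₁ : Fin m → Γ(X, (U₁ : X.Opens)) := fun k => X.presheaf.map (homOfLE h₁b).op (fb k) with hf₁def
  have hg₁ : ∀ j, X.presheaf.germ (U₁ : X.Opens) x hx₁ (g₁ j) = g j := fun j => by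
    rw [hg₁def, germ_map_homOfLE, hga]
  have hf₁ : ∀ k, X.presheaf.germ (U₁ : X.Opens) x hx₁ (f₁ k) = f k := fun k => by
    rw [hf₁def, germ_map_homOfLE, hfb]
  -- the coordinate ring `Γ(X, (U₁ : X.Opens))` and the stalk as its localization at the prime of `x`
  haveI : IsNoetherianRing Γ(X, (U₁ : X.Opens)) := IsLocallyNoetherian.component_noetherian U₁
  letI := X.presheaf.algebra_section_stalk (⟨x, hx₁⟩ : (U₁ : X.Opens))
  haveI := U₁.2.isLocalization_stalk ⟨x, hx₁⟩
  set 𝔮 : Ideal Γ(X, (U₁ : X.Opens)) := (U₁.2.primeIdealOf ⟨x, hx₁⟩).asIdeal with h𝔮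
  have hgerm : ∀ s : Γ(X, (U₁ : X.Opens)), algebraMap Γ(X, (U₁ : X.Opens)) (X.presheaf.stalk x) s = X.presheaf.germ (U₁ : X.Opens) x hx₁ s :=
    fun s => rfl
  have hmem𝔮 : ∀ s : Γ(X, (U₁ : X.Opens)), s ∈ 𝔮 ↔ ¬ IsUnit (X.presheaf.germ (U₁ : X.Opens) x hx₁ s) := fun s => by
    rw [← hgerm, ← IsLocalization.AtPrime.to_map_mem_maximal_iff (X.presheaf.stalk x) 𝔮 s,
      IsLocalRing.mem_maximalIdeal, mem_nonunits_iff]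
  -- (1) the boundary ideals vs the principal ideals, at the prime of `x`
  have hI : ∀ j, ((D j).1.ideal U₁).map (algebraMap Γ(X, (U₁ : X.Opens)) (X.presheaf.stalk x)) =
      (Ideal.span {g₁ j}).map (algebraMap Γ(X, (U₁ : X.Opens)) (X.presheaf.stalk x)) := fun j => by
    rw [Ideal.map_span, Set.image_singleton, hgerm, hg₁, ← hg j,
      stalkIdeal_eq_map_germ (D j).1 U₁ hx₁]
    rfl
  have hP : ∀ j, ((Ideal.span {g j}).comap (algebraMap Γ(X, (U₁ : X.Opens)) (X.presheaf.stalk x))).map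
      (algebraMap Γ(X, (U₁ : X.Opens)) (X.presheaf.stalk x)) =
      (Ideal.span {g₁ j}).map (algebraMap Γ(X, (U₁ : X.Opens)) (X.presheaf.stalk x)) := fun j => by
    rw [Ideal.map_span, Set.image_singleton, hgerm, hg₁]
    exact IsLocalization.map_under 𝔮.primeCompl (X.presheaf.stalk x) _
  choose e he he' using fun j => exists_notMem_map_eq_of_map_eq_atPrime 𝔮
    (IsNoetherian.noetherian ((D j).1.ideal U₁)) ⟨{g₁ j}, by simp⟩ (hI j)
  choose e' he₁ he₁' using fun j => exists_notMem_map_eq_of_map_eq_atPrime 𝔮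
    (IsNoetherian.noetherian ((Ideal.span {g j}).comap (algebraMap Γ(X, (U₁ : X.Opens)) (X.presheaf.stalk x))))
    ⟨{g₁ j}, by simp⟩ (hP j)
  -- (2) the units
  have hu𝔮 : ∀ k, u₁ k ∉ 𝔮 := fun k => by
    rw [hmem𝔮, not_not, hu₁]; exact huu k
  -- (3) the members of `E` not through `x`
  have hother : ∀ D' ∈ E, (∀ j, (D j).1 ≠ D') → ∃ y ∈ D'.ideal U₁, y ∉ 𝔮 := by
    intro D' hD' hne
    have hxD' : x ∉ D'.support := fun h => by
      obtain ⟨j, hj⟩ := hDsurj D' hD' h; exact hne j hj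
    rw [Scheme.IdealSheafData.mem_support_iff_of_mem (U := U₁) hx₁, Scheme.mem_zeroLocus_iff] at hxD'
    push Not at hxD'
    obtain ⟨y, hy, hxy⟩ := hxD'
    refine ⟨y, hy, ?_⟩
    rw [hmem𝔮, not_not]
    exact (X.mem_basicOpen y x hx₁).mp hxy
  choose! y hy hy' using hother
  -- the element to invert
  set T : Finset Γ(X, (U₁ : X.Opens)) := (Finset.univ.image e ∪ Finset.univ.image e') ∪ Finset.univ.image u₁ ∪
    (E.toFinset.filter fun D' => ∀ j, (D j).1 ≠ D').image y with hT
  set F : Γ(X, (U₁ : X.Opens)) := ∏ z ∈ T, z with hF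
  have hT𝔮 : ∀ z ∈ T, z ∉ 𝔮 := by
    intro z hz
    simp only [hT, Finset.mem_union, Finset.mem_image, Finset.mem_univ, true_and,
      Finset.mem_filter, List.mem_toFinset] at hz
    rcases hz with ((⟨j, rfl⟩ | ⟨j, rfl⟩) | ⟨k, rfl⟩) | ⟨D', ⟨hD', hne⟩, rfl⟩
    · exact he j
    · exact he₁ j
    · exact hu𝔮 k
    · exact hy' D' hD' hne
  have hF𝔮 : F ∉ 𝔮 := fun h => by
    obtain ⟨z, hz, hz'⟩ := (Ideal.IsPrime.prod_mem_iff_exists_mem inferInstance T).mp h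
    exact hT𝔮 z hz hz'
  have hdvd : ∀ z ∈ T, z ∣ F := fun z hz => Finset.dvd_prod_of_mem _ hz
  -- the basic open neighbourhood `U = D(F)`
  have hxF : x ∈ X.basicOpen F := by
    rw [X.mem_basicOpen F x hx₁]
    have := (hmem𝔮 F).not.mp hF𝔮
    rwa [not_not] at this
  let U : X.affineOpens := ⟨X.basicOpen F, U₁.2.basicOpen F⟩
  have hUU₁ : (U : X.Opens) ≤ U₁ := X.basicOpen_le F
  haveI hloc : IsLocalization.Away F Γ(X, (U : X.Opens)) := U₁.2.isLocalization_basicOpen F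
  have hres : ∀ s : Γ(X, (U₁ : X.Opens)), algebraMap Γ(X, (U₁ : X.Opens)) Γ(X, (U : X.Opens)) s = X.presheaf.map (homOfLE hUU₁).op s :=
    fun s => rfl
  have hFunit : IsUnit (algebraMap Γ(X, (U₁ : X.Opens)) Γ(X, (U : X.Opens)) F) := IsLocalization.Away.algebraMap_isUnit F
  have hTunit : ∀ z ∈ T, IsUnit (algebraMap Γ(X, (U₁ : X.Opens)) Γ(X, (U : X.Opens)) z) := fun z hz =>
    isUnit_of_dvd_unit (map_dvd _ (hdvd z hz)) hFunit
  have hmemT_e : ∀ j, e j ∈ T := fun j => by simp [hT]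
  have hmemT_e' : ∀ j, e' j ∈ T := fun j => by simp [hT]
  have hmemT_u : ∀ k, u₁ k ∈ T := fun k => by simp [hT]
  have hmemT_y : ∀ D' ∈ E, (∀ j, (D j).1 ≠ D') → y D' ∈ T := fun D' hD' hne => by
    simp only [hT, Finset.mem_union, Finset.mem_image, Finset.mem_filter, List.mem_toFinset]
    exact Or.inr ⟨D', ⟨hD', hne⟩, rfl⟩
  refine ⟨U, hxF, fun j => algebraMap Γ(X, (U₁ : X.Opens)) _ (g₁ j), fun k => algebraMap Γ(X, (U₁ : X.Opens)) _ (f₁ k),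
    fun k => algebraMap Γ(X, (U₁ : X.Opens)) _ (u₁ k), fun j => ?_, fun k => ?_, fun k => ?_,
    fun k => hTunit _ (hmemT_u k), fun j => ?_, fun D' hD' hne => ?_, fun j => ?_⟩
  · change X.presheaf.germ _ x hxF (algebraMap _ _ (g₁ j)) = _
    rw [hres, germ_map_homOfLE, hg₁]
  · change X.presheaf.germ _ x hxF (algebraMap _ _ (f₁ k)) = _
    rw [hres, germ_map_homOfLE, hf₁]
  · change X.presheaf.germ _ x hxF (algebraMap _ _ (u₁ k)) = _
    rw [hres, germ_map_homOfLE, hu₁]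
  · -- the boundary ideal on `U`
    rw [← (D j).1.map_ideal hUU₁]
    change ((D j).1.ideal U₁).map (algebraMap Γ(X, (U₁ : X.Opens)) Γ(X, (U : X.Opens))) = _
    rw [he' j _ (hTunit _ (hmemT_e j)), Ideal.map_span, Set.image_singleton]
  · -- the other members of `E`
    rw [← D'.map_ideal hUU₁]
    change (D'.ideal U₁).map (algebraMap Γ(X, (U₁ : X.Opens)) Γ(X, (U : X.Opens))) = ⊤
    exact Ideal.eq_top_of_isUnit_mem _ (Ideal.mem_map_of_mem _ (hy D' hD' hne))
      (hTunit _ (hmemT_y D' hD' hne))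
  · -- primality
    have heq := he₁' j _ (hTunit _ (hmemT_e' j))
    rw [Ideal.map_span, Set.image_singleton] at heq
    rw [← heq]
    have hQ : ((Ideal.span {g j}).comap (algebraMap Γ(X, (U₁ : X.Opens)) (X.presheaf.stalk x))).IsPrime :=
      Ideal.comap_isPrime _ _
    refine IsLocalization.isPrime_of_isPrime_disjoint (Submonoid.powers F) Γ(X, (U : X.Opens)) _ hQ ?_
    have hQle : (Ideal.span {g j}).comap (algebraMap Γ(X, (U₁ : X.Opens)) (X.presheaf.stalk x)) ≤ 𝔮 := by
      intro z hz
      rw [Ideal.mem_comap] at hz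
      rw [hmem𝔮, ← hgerm]
      intro hu
      exact (hgprime j).ne_top (Ideal.eq_top_of_isUnit_mem _ hz hu)
    rw [Set.disjoint_left]
    rintro _ ⟨n, rfl⟩ hmem
    exact hF𝔮 (hQle (hQ.mem_of_pow_mem n hmem))

end Literature.AlgebraicGeometry.Resolution

end
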